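import Summits.ResolutionOfSingularities.ResolutionOfSingularities.Theorems.PurelyInseparableDim4IsolatedBand
import Summits.ResolutionOfSingularities.ResolutionOfSingularities.Theorems.PurelyInseparableDim4FreeTail
import HarnessLib
import HarnessLib.Audit.Tags

/-!
# Purely inseparable four-folds — the SHAPE LEMMA (SH3) of card I-7-2: two point blow-ups in the
# order-4 band at `q = 3`, the second one SATELLITE, never end at an ISOLATED 3-fold point
# [OURS · counted 0 · cell res-dim4-pi · idea-7's card I-7-2 (statements, hand proof) · p-9 (Lean)]

Census cell «res-dim4-pi» (D-0157 DOOR 2), frame v4 TIER 1 (I) = the ISOLATED regime (`PIDim4.IsIsolated`,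
Scope add-on), exponent of record `q = p = 3`.  By p-5's band theorem (`PurelyInseparableDim4IsolatedBand`,
`isolated_chain_band`) an infinite `Step0`-branch of isolated `3`-fold states lives in the band
`3 ≤ ord₀ F ≤ 4`.  Card I-7-2 (res-dim4-idea-7) reduces the question «no such branch with `ord₀ ≡ 4`»
(`NoIsolatedBandRun3`) to a FREE-TAIL LEMMA (FT, open) and a SHAPE LEMMA (SH3); the statements are
idea-7's `FreeTailSketch.lean` (sha16 e460a65b386a7a24), filed by res-dim4-typ-1 as
`PurelyInseparableDim4FreeTail.lean` (imported; `IsWitnessedChain`, `IsSatellite`, `ShapeLemma3`, …).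
THIS FILE PROVES (SH3):

**`FreeTail.shapeLemma3 : ShapeLemma3`** — along a witnessed `Step0` chain at `q = 3`, if `c k` and
`c (k+1)` both have residual order `4` and step `k+1` is SATELLITE w.r.t. the hyperplane created at step
`k` (another chart `j (k+1) ≠ j k`, no translation in `x_{j k}`), then `c (k+2)` is NOT an isolated
3-fold point.  Proof (idea-7's hand proof, card I-7-2): every monomial of `(c (k+2)).F` is divisible by
`x_{j k} · x_{j (k+1)}` (§1: the `x_j`-layer of a successor of an order-4 state starts at `1`
— p-5's `IsolatedBand.apply_ge_of_mem_support_step` —, and a kept untranslated variable keeps its layer —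
`apply_ge_of_mem_support_step_of_ne`); for such a `P` the 3-fold locus ideal `J₃⁺(P)` lies in the
THREE-generated ideal `(x_a, x_b, D^{(e_a+e_b)} P)` (§2, the two-variable layer lemma: every other Hasse
derivative of order `< 3` misses one of the two variables); a minimal prime of a 3-generated ideal has
height `≤ 3 < 4 ≤ ht 𝔪₀` (Krull; p-5's `four_le_height_originIdeal`), so the origin is not isolated
(§2 `not_isIsolated_of_le_span_triple`, the three-generator sibling of p-5's pair lemma) — or
`D^{(e_a+e_b)} P ∉ 𝔪₀` and `J₃⁺(P) ≰ 𝔪₀` outright.  Isolation of `c k`, `c (k+1)` is not used.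

With (FT) `NoIsolatedFreeTail 3` (open; idea-7: the frozen-monomial argument of `IsoSpine` in arc-adapted
formal coordinates) idea-7's assembly `noIsolatedBandRun3_of` gives K2(3).  Nothing in this file is a
statement about resolution of singularities; resolution in dimension ≥ 4 / characteristic `p` is NOT
proved anywhere in this programme; counted 0; AI formalisation, weaker than expert review.
bears_on: LADDER-RESOLUTION:D157-DOOR2 (res-dim4-pi · I-7-2 SH3). Supports stmt-ResolutionOfSingularities-16155 (helper).
-/

set_option linter.dupNamespace false

noncomputable section

namespace Summit.ResolutionOfSingularities.ResolutionOfSingularities.Theorems.PIDim4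

namespace FreeTail

open MvPolynomial Finset
open Literature.AlgebraicGeometry.Resolution
open Literature.AlgebraicGeometry.Resolution.CentreBlowup
open Literature.AlgebraicGeometry.Resolution.Hauser2010

variable {K : Type} [Field K]

/-! ## 1. The `x_i`-layer of a kept, untranslated variable survives a step -/

/-- **A kept variable keeps its layer**: if every monomial of `s.F` has `x_i`-exponent `≥ n`, the step is
taken in another chart `j ≠ i` and the point `b` does not translate `x_i` (`b_i = 0`), then every
monomial of `(step q S j b s).F` has `x_i`-exponent `≥ n` (the chart law fixes the `i`-th exponent,
the translation and the cleaning do not lower it). [folklore] -/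
theorem apply_ge_of_mem_support_step_of_ne [DecidableEq K] {q n : ℕ} {S : Finset (Fin 4)}
    {j i : Fin 4} (hij : i ≠ j) {b : Fin 4 → K} (hbi : b i = 0) (s : State K)
    (hn : ∀ d ∈ s.F.support, n ≤ d i) {e : Fin 4 →₀ ℕ}
    (he : e ∈ (CentreBlowup.step q S j b s).F.support) : n ≤ e i := by
  have he1 := IsolatedBand.mem_support_of_mem_support_deletePthPowers' q _ he
  obtain ⟨E, hE, heE⟩ := IsolatedBand.exists_apply_eq_of_mem_support_translate hbi _ he1
  rw [heE]
  obtain ⟨d, hd, rfl⟩ := Perm2Bound.exists_of_mem_support_chartTransform q S j s.F hE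
  rw [chartExponent_apply_of_ne q S hij]
  exact hn d hd

/-- Along a witnessed chain at `q = 3`, a state of residual order `4` hands its successor the layer
`x_{j k} ∣` (every monomial of `(c (k+1)).F` has `x_{j k}`-exponent `≥ 1`). [folklore] -/
theorem one_le_apply_of_ordZero_eq_four [DecidableEq K] {c : ℕ → State K} {j : ℕ → Fin 4}
    {b : ℕ → Fin 4 → K} (hw : IsWitnessedChain 3 c j b) {k : ℕ} (ho : ordZero (c k).F = (4 : ℕ∞)) :
    ∀ e ∈ (c (k + 1)).F.support, 1 ≤ e (j k) := by
  intro e he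
  obtain ⟨-, hbj, -, -, hstep⟩ := hw k
  rw [hstep] at he
  have h4 : ((4 : ℕ) : ℕ∞) ≤ ordAlong Finset.univ (c k).F := by
    rw [ordAlong_univ, ho]
    exact le_rfl
  have := IsolatedBand.apply_ge_of_mem_support_step (q := 3) hbj (c k) h4 he
  omega

/-! ## 2. Three generators in `𝔪₀` never isolate the origin; the two-variable layer lemma at `q = 3` -/

/-- **Three generators in `𝔪₀` never make the origin an isolated `q`-fold point** (the sibling of p-5's
`IsolatedBand.not_isIsolated_of_le_span_pair`): if `J_q⁺(G) ≤ (f, g, h)` with `f, g, h ∈ 𝔪₀`, a minimal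
prime of `(f, g, h)` has height `≤ 3 < 4 ≤ ht 𝔪₀` (Krull), and below it lies a minimal prime of `J_q⁺(G)`
strictly inside `𝔪₀`. [folklore] -/
theorem not_isIsolated_of_le_span_triple {q : ℕ} {G f g h : MvPolynomial (Fin 4) K}
    (hJ : singLocusIdeal q G ≤ Ideal.span {f, g, h}) (hf : f ∈ originIdeal K)
    (hg : g ∈ originIdeal K) (hh : h ∈ originIdeal K) : ¬ IsIsolated q G := by
  classical
  haveI := IsolatedBand.originIdeal_isPrime (K := K)
  have hI : Ideal.span ({f, g, h} : Set (MvPolynomial (Fin 4) K)) ≤ originIdeal K := by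
    rw [Ideal.span_le]
    rintro x hx
    rcases hx with rfl | hx
    · exact hf
    · rcases hx with rfl | hx
      · exact hg
      · rw [Set.mem_singleton_iff] at hx
        subst hx
        exact hh
  obtain ⟨P₁, hP₁, hP₁le⟩ := Ideal.exists_minimalPrimes_le hI
  haveI hP₁prime : P₁.IsPrime := hP₁.1.1
  have hht : P₁.height ≤ 3 := by
    have hset : ({f, g, h} : Set (MvPolynomial (Fin 4) K)) = (({f, g, h} : Finset _) : Set _) := by
      rw [Finset.coe_insert, Finset.coe_insert, Finset.coe_singleton]
    rw [hset] at hP₁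
    refine le_trans (Ideal.height_le_card_of_mem_minimalPrimes_span_finset hP₁) ?_
    exact_mod_cast Finset.card_le_three
  have hne : P₁ ≠ originIdeal K := by
    intro hP
    rw [hP] at hht
    have h4 := IsolatedBand.four_le_height_originIdeal (K := K)
    have : (4 : ℕ∞) ≤ 3 := le_trans h4 hht
    exact absurd this (by decide)
  rintro ⟨-, hall⟩
  obtain ⟨P, hP, hPle⟩ := Ideal.exists_minimalPrimes_le (hJ.trans hP₁.1.2)
  have hP𝔪 : P = originIdeal K := hall P hP (hPle.trans hP₁le)
  exact hne (le_antisymm hP₁le (hP𝔪 ▸ hPle))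

/-- An exponent `α` of total degree `< 3` with `α_a ≥ 1` and `α_b ≥ 1` (`a ≠ b`) is `e_a + e_b`. [folklore] -/
theorem eq_single_add_single_of_degree_lt_three {a b : Fin 4} (hab : a ≠ b) {α : Fin 4 →₀ ℕ}
    (hα : α.degree < 3) (ha : 1 ≤ α a) (hb : 1 ≤ α b) :
    α = Finsupp.single a 1 + Finsupp.single b 1 := by
  classical
  have hsum : α.degree = α a + (α b + ∑ i ∈ (Finset.univ.erase a).erase b, α i) := by
    rw [Finsupp.degree_eq_sum, ← Finset.add_sum_erase _ _ (Finset.mem_univ a),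
      ← Finset.add_sum_erase _ _ (Finset.mem_erase.mpr ⟨hab.symm, Finset.mem_univ b⟩)]
  have ha1 : α a = 1 := by omega
  have hb1 : α b = 1 := by omega
  have hrest : ∑ i ∈ (Finset.univ.erase a).erase b, α i = 0 := by omega
  ext i
  rw [Finsupp.add_apply, Finsupp.single_apply, Finsupp.single_apply]
  by_cases hia : a = i
  · rw [if_pos hia, if_neg (fun h : b = i => hab (hia.trans h.symm))]
    subst hia
    omega
  · by_cases hib : b = i
    · rw [if_neg hia, if_pos hib]
      subst hib
      omega
    · rw [if_neg hia, if_neg hib]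
      exact Finset.sum_eq_zero_iff.mp hrest i
        (Finset.mem_erase.mpr ⟨fun h => hib h.symm,
          Finset.mem_erase.mpr ⟨fun h => hia h.symm, Finset.mem_univ i⟩⟩)

/-- **THE TWO-VARIABLE LAYER LEMMA at `q = 3`.** If every monomial of `P` is divisible by `x_a x_b`
(`a ≠ b`), then `J₃⁺(P) ≤ (x_a, x_b, D^{(e_a+e_b)} P)`: a Hasse derivative of order `1` or `2` other than
`D^{(e_a+e_b)}` misses `x_a` or `x_b` and stays in that variable's ideal
(p-5's `IsolatedBand.hasseDeriv_mem_span_X_of_layer`). [folklore] -/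
theorem singLocusIdeal_three_le_span_triple_of_two_layers {a b : Fin 4} (hab : a ≠ b)
    {P : MvPolynomial (Fin 4) K} (ha : ∀ e ∈ P.support, 1 ≤ e a) (hb : ∀ e ∈ P.support, 1 ≤ e b) :
    singLocusIdeal 3 P ≤ Ideal.span {(X a : MvPolynomial (Fin 4) K), X b,
      hasseDeriv (Finsupp.single a 1 + Finsupp.single b 1) P} := by
  classical
  unfold singLocusIdeal
  rw [Ideal.span_le]
  rintro _ ⟨α, -, hαq, rfl⟩
  by_cases hαa : α a = 0
  · have hmem := IsolatedBand.hasseDeriv_mem_span_X_of_layer ha (show α a < 1 by omega)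
    exact Ideal.span_mono (Set.singleton_subset_iff.mpr (Set.mem_insert _ _)) hmem
  · by_cases hαb : α b = 0
    · have hmem := IsolatedBand.hasseDeriv_mem_span_X_of_layer hb (show α b < 1 by omega)
      exact Ideal.span_mono (Set.singleton_subset_iff.mpr
        (Set.mem_insert_of_mem _ (Set.mem_insert _ _))) hmem
    · have hα := eq_single_add_single_of_degree_lt_three hab hαq (by omega) (by omega)
      subst hα
      exact Ideal.subset_span (Set.mem_insert_of_mem _ (Set.mem_insert_of_mem _ rfl))

/-- **Not isolated off two layers**: a polynomial all of whose monomials are divisible by `x_a x_b`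
(`a ≠ b`) never presents an isolated 3-fold point at the origin. [folklore] -/
theorem not_isIsolated_three_of_two_layers {a b : Fin 4} (hab : a ≠ b) {P : MvPolynomial (Fin 4) K}
    (ha : ∀ e ∈ P.support, 1 ≤ e a) (hb : ∀ e ∈ P.support, 1 ≤ e b) : ¬ IsIsolated 3 P := by
  classical
  have hJ := singLocusIdeal_three_le_span_triple_of_two_layers hab ha hb
  set D := hasseDeriv (Finsupp.single a 1 + Finsupp.single b 1) P with hDdef
  by_cases hD : D ∈ originIdeal K
  · exact not_isIsolated_of_le_span_triple hJ (IsolatedScope.X_mem_originIdeal a)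
      (IsolatedScope.X_mem_originIdeal b) hD
  · -- `D` is itself a generator of `J₃⁺(P)` (order 2), so `J₃⁺(P) ≰ 𝔪₀`
    rintro ⟨hle, -⟩
    apply hD
    refine hle (Ideal.subset_span ⟨Finsupp.single a 1 + Finsupp.single b 1, ?_, ?_, rfl⟩)
    · rw [map_add, Finsupp.degree_single, Finsupp.degree_single]
      decide
    · rw [map_add, Finsupp.degree_single, Finsupp.degree_single]
      decide

/-! ## 3. The shape lemma -/

/-- **SHAPE LEMMA (SH3) — card I-7-2 (res-dim4-idea-7), kernel form.**  At `q = 3`, along a witnessed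
`Step0` chain: if `c k` and `c (k+1)` have residual order `4` and step `k+1` is satellite w.r.t. the
hyperplane created at step `k`, then `c (k+2)` is not an isolated 3-fold point — its residual
polynomial is divisible by `x_{j k} x_{j (k+1)}` monomialwise (§1) and §2 applies.  No characteristic,
permissibility or isolation hypothesis on `c k`, `c (k+1)` is used. [folklore] -/
theorem shapeLemma3 : ShapeLemma3 := by
  intro K _ _ _ c j b k hw hk hk1 hsat
  obtain ⟨hne, hb0⟩ := hsat
  -- layer of the hyperplane created at step `k`, carried through the satellite step `k+1`
  have ha1 : ∀ e ∈ (c (k + 1)).F.support, 1 ≤ e (j k) := one_le_apply_of_ordZero_eq_four hw hk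
  have ha2 : ∀ e ∈ (c (k + 2)).F.support, 1 ≤ e (j k) := by
    intro e he
    obtain ⟨-, -, -, -, hstep⟩ := hw (k + 1)
    rw [hstep] at he
    exact apply_ge_of_mem_support_step_of_ne hne.symm hb0 (c (k + 1)) ha1 he
  -- layer of the hyperplane created at step `k+1`
  have hb2 : ∀ e ∈ (c (k + 2)).F.support, 1 ≤ e (j (k + 1)) :=
    one_le_apply_of_ordZero_eq_four hw hk1
  exact not_isIsolated_three_of_two_layers hne.symm ha2 hb2

end FreeTail

end Summit.ResolutionOfSingularities.ResolutionOfSingularities.Theorems.PIDim4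

end
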